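import Summits.ResolutionOfSingularities.ResolutionOfSingularities.Theorems.WeightDescentClasses
import Summits.ResolutionOfSingularities.ResolutionOfSingularities.Theorems.CornerTowerDynamics
import HarnessLib

/-!
# WeightDescentKernels — decomp-res node «WeightDescent» (lens-4 g16; CRITIC-LEDGER row 108 CLEARED:
DECIDED-MOD-PORT +2 cells)
refining the MaxContactCut aside 32260 (host of the lens-4 column).  Tree file 2/3 of the node.

Content VERBATIM from the decomp-res lens-4 cumulative file `HOME/decomp-res-lens-4/g18/CouplingCut.lean` (sha256
5bf7b2ca8f7311e8;
its §1–§6 = g14 HugValuationCut, ALREADY in the tree as `Theorems/HugValuationCut{Chains,Classes,Kernels}` +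
`MaxContactCutHugValuationCut`; §7–§12 = g15 «MarkingBudget» @369c12ac; §13–§17 = g16 «WeightDescent»
@1cb1c32f; §18–§23 = g17
«FactorContact» @daf245ab; §24–§31 = g18 «CouplingCut»).  HOME = run/shared/lean/pub/decomp-res.

Route-independent, cone-free: §16 the KERNELS (PROVED) — the exact cut of the in-locus column by principal axis
× purity × factor
isolation (`inLocus_iff_cells`, `principalInLocus_iff_cells`, `factorIsolated_iff_halves`), factor isolation from
the descent port
(`factorIsolated_of_descent`), the in-locus column from the g16 residuals and ALL LOWER WEIGHTS
(`inLocus_iff_residuals_of_lower`,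
`singularSurface_iff_g16`) and the step of the strong induction on the weight `ftt_step_of_g16` (tree
`SurfaceShadowKernels.ftt_iff_g11_leaves`,
corner hypothesis discharged by `CornerTowerDynamics.noCornerTowers_tree`).

[WRITER NOTE (decomp-res writer g6): the whole lens-4 chain lives in ONE namespace `…Theorems.HugValuationCut` (the tree's g14
namespace) so that the lens's `HugChain.`/`HugShadow.`/`MarkedShadow.` dot-notation extends the landed structures
verbatim; the lens's
`noTower_iff_perfect_and_imperfect` is the tree's `ContactShadowKernels.noTower_iff_columns`; `set_option` lines
dropped; cone-free
(no `Theses` import) so the route file can import it for asides; the BY-NAME wiring to the MaxContactCut items is in the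
`MaxContactCut<Node>` companion files.]
(Sources: CossartJannsenSaito2020 Key Thm. 6.40, Cor. 6.37, Lem. 6.35/6.36; BierstoneGrigorievMilmanWlodarczyk2011
§3 (marked ideals, Lem. 3.2.1, §3.7); CossartPiltant2019; Abhyankar1956; Cutkosky2009 §2.1.)
-/

noncomputable section

open CategoryTheory AlgebraicGeometry IsLocalRing
open Literature.AlgebraicGeometry.Resolution
open Summit.ResolutionOfSingularities.ResolutionOfSingularities.Theorems
open WeakOrderReduction ForcedTowerClasses DivergentTowerClasses MonomialTowerClasses
open HugDimensionClasses HugDimensionKernels SurfaceShadowClasses SurfaceShadowKernels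
open ContactShadowClasses (NoTowerImperfect)
open ContactShadowKernels (noTowerImperfect_of_noTower noTowerImperfect_mono noTower_iff_columns)
open NearPointCut (SingularClass singularSurface_iff_noTower)

namespace Summit.ResolutionOfSingularities.ResolutionOfSingularities.Theorems.HugValuationCut

variable {K : Type} [Field K]

/-! ## §16 (g16 · NEW) Kernels (PROVED) -/

/-- Necessity, PORT-FREE: (L) implies every g16 cell (sub-classes). [folklore] -/
theorem cells_of_inLocus {n : ℕ} (h : InLocusShadowTowersTerminate n) :
    NonPrincipalInLocusTowersTerminate n ∧ PurePrincipalTowersTerminate n ∧ FactorIsolatedTowersTerminate n ∧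
      DriftingTowersTerminate n ∧ TopIsolatedImpureTowersTerminate n ∧ TailIsolatedImpureTowersTerminate n ∧
        PrincipalInLocusTowersTerminate n :=
  ⟨noTower_mono (fun _ h' => ⟨h'.1, h'.2.1⟩) h, noTower_mono (fun _ h' => ⟨h'.1, h'.2.1⟩) h,
    noTower_mono (fun _ h' => ⟨h'.1, h'.2.1⟩) h, noTower_mono (fun _ h' => ⟨h'.1, h'.2.1⟩) h,
    noTower_mono (fun _ h' => ⟨h'.1, h'.2.1⟩) h, noTower_mono (fun _ h' => ⟨h'.1, h'.2.1⟩) h,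
    noTower_mono (fun _ h' => ⟨h'.1, h'.2.1⟩) h⟩

/-- Necessity at the target, PORT-FREE: 32260 at weight `n` implies every g16 cell. [folklore] -/
theorem cells_of_singularSurface {n : ℕ} (h : SingularSurfaceHuggingTowersTerminate n) :
    NonPrincipalInLocusTowersTerminate n ∧ PurePrincipalTowersTerminate n ∧ FactorIsolatedTowersTerminate n ∧
      DriftingTowersTerminate n :=
  let hL := (pieces_of_singularSurface_g15 h).2.2.2.1
  ⟨(cells_of_inLocus hL).1, (cells_of_inLocus hL).2.1, (cells_of_inLocus hL).2.2.1, (cells_of_inLocus hL).2.2.2.1⟩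

/-- **KERNEL — THE EXACT PRINCIPAL-AXIS CUT of the in-locus column (L), PORT-FREE, pure logic**:
`(L) ⟺ (L, ¬P) ∧ (L, P, pure) ∧ (L, P, factor-isolated) ∧ (L, P, drifting)`. [folklore] -/
theorem inLocus_iff_cells {n : ℕ} :
    InLocusShadowTowersTerminate n ↔ NonPrincipalInLocusTowersTerminate n ∧ PurePrincipalTowersTerminate n ∧
      FactorIsolatedTowersTerminate n ∧ DriftingTowersTerminate n := by
  refine ⟨fun h => ⟨(cells_of_inLocus h).1, (cells_of_inLocus h).2.1, (cells_of_inLocus h).2.2.1,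
    (cells_of_inLocus h).2.2.2.1⟩, ?_⟩
  rintro ⟨h₁, h₂, h₃, h₄⟩ p hp k _ _ T g hB hD hE ⟨hS, hL⟩
  by_cases hPr : PrincipalShadow T
  · obtain ⟨S, hP⟩ := hPr
    by_cases hpu : S.Pure n
    · exact h₂ p hp k T g hB hD hE ⟨hS, hL, S, hP, hpu⟩
    · rcases S.factorIsolated_or_drifting n with hF | hDr
      · exact h₃ p hp k T g hB hD hE ⟨hS, hL, S, hP, hpu, hF⟩
      · exact h₄ p hp k T g hB hD hE ⟨hS, hL, S, hP, hpu, hDr⟩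
  · exact h₁ p hp k T g hB hD hE ⟨hS, hL, not_principalShadow_iff.mp hPr⟩

/-- the factor-isolated cell is exactly its two halves (pure logic). [folklore] -/
theorem factorIsolated_iff_halves {n : ℕ} :
    FactorIsolatedTowersTerminate n ↔ TopIsolatedImpureTowersTerminate n ∧ TailIsolatedImpureTowersTerminate n := by
  refine ⟨fun h => ⟨noTower_mono (fun _ h' => ?_) h, noTower_mono (fun _ h' => ?_) h⟩, ?_⟩
  · obtain ⟨hS, hL, S, hP, hnp, hT⟩ := h'
    exact ⟨hS, hL, S, hP, hnp, Or.inl hT⟩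
  · obtain ⟨hS, hL, S, hP, hnp, hT⟩ := h'
    exact ⟨hS, hL, S, hP, hnp, Or.inr hT⟩
  · rintro ⟨h₁, h₂⟩ p hp k _ _ T g hB hD hE ⟨hS, hL, S, hP, hnp, hF⟩
    rcases hF with hT | hT
    · exact h₁ p hp k T g hB hD hE ⟨hS, hL, S, hP, hnp, hT⟩
    · exact h₂ p hp k T g hB hD hE ⟨hS, hL, S, hP, hnp, hT⟩

/-- the principal column is exactly its three cells (pure logic). [folklore] -/
theorem principalInLocus_iff_cells {n : ℕ} :
    PrincipalInLocusTowersTerminate n ↔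
      PurePrincipalTowersTerminate n ∧ FactorIsolatedTowersTerminate n ∧ DriftingTowersTerminate n := by
  refine ⟨fun h => ⟨noTower_mono (fun _ h' => ?_) h, noTower_mono (fun _ h' => ?_) h,
    noTower_mono (fun _ h' => ?_) h⟩, ?_⟩
  · obtain ⟨hS, hL, S, hP, -⟩ := h'
    exact ⟨hS, hL, S, hP⟩
  · obtain ⟨hS, hL, S, hP, -⟩ := h'
    exact ⟨hS, hL, S, hP⟩
  · obtain ⟨hS, hL, S, hP, -⟩ := h'
    exact ⟨hS, hL, S, hP⟩
  · rintro ⟨h₂, h₃, h₄⟩ p hp k _ _ T g hB hD hE ⟨hS, hL, S, hP⟩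
    by_cases hpu : S.Pure n
    · exact h₂ p hp k T g hB hD hE ⟨hS, hL, S, hP, hpu⟩
    · rcases S.factorIsolated_or_drifting n with hF | hDr
      · exact h₃ p hp k T g hB hD hE ⟨hS, hL, S, hP, hpu, hF⟩
      · exact h₄ p hp k T g hB hD hE ⟨hS, hL, S, hP, hpu, hDr⟩

/-- **KERNEL — WEIGHT DESCENT: the factor-isolated cell at weight `n` is EMPTY as soon as forced towers of every
LOWER weight terminate** (modulo the COSTUME port).  The induction step of the minimal-counterexample argument.
[folklore] -/
theorem factorIsolated_of_descent {n : ℕ} (hDesc : DescentPort n)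
    (hlow : ∀ n' : ℕ, 1 ≤ n' → n' < n → ForcedTowersTerminate n') : FactorIsolatedTowersTerminate n := by
  intro p hp k _ _ T g hB hD hE hT
  obtain ⟨hS, hL, S, hP, hnp, hF⟩ := hT
  obtain ⟨n', h1, h2, T', g', hB', hD', hE'⟩ := hDesc p hp k T g hB hD hE hS S (hL.2 S) hP hnp hF
  exact hlow n' h1 h2 p hp k T' g' hB' hD' hE'

/-- **THE MINIMAL-WEIGHT NORMAL FORM** (modulo the COSTUME port): below a weight at which all lower forced towers
terminate, the in-locus column is EXACTLY `(L, ¬P) ∧ (L, P, pure) ∧ (L, P, drifting)` — a minimal-weight in-locus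
counterexample hugs a codimension-two surface, or is PURE, or DRIFTS. [folklore] -/
theorem inLocus_iff_residuals_of_lower {n : ℕ} (hDesc : DescentPort n)
    (hlow : ∀ n' : ℕ, 1 ≤ n' → n' < n → ForcedTowersTerminate n') :
    InLocusShadowTowersTerminate n ↔
      NonPrincipalInLocusTowersTerminate n ∧ PurePrincipalTowersTerminate n ∧ DriftingTowersTerminate n :=
  ⟨fun h => ⟨(cells_of_inLocus h).1, (cells_of_inLocus h).2.1, (cells_of_inLocus h).2.2.2.1⟩,
    fun h => inLocus_iff_cells.mpr ⟨h.1, h.2.1, factorIsolated_of_descent hDesc hlow, h.2.2⟩⟩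

/-- **KERNEL — (L) at weight `n` from the three g16 residual cells, the COSTUME port and the LOWER WEIGHTS.**
[folklore] -/
theorem inLocus_of_g16 {n : ℕ} (hDesc : DescentPort n) (hlow : ∀ n' : ℕ, 1 ≤ n' → n' < n → ForcedTowersTerminate n')
    (hNP : NonPrincipalInLocusTowersTerminate n) (hPu : PurePrincipalTowersTerminate n)
    (hDr : DriftingTowersTerminate n) : InLocusShadowTowersTerminate n :=
  (inLocus_iff_residuals_of_lower hDesc hlow).mpr ⟨hNP, hPu, hDr⟩

/-- **KERNEL — THE TARGET LEAF 32260 at weight `n`** from g15's off-locus residual (O), the three g16 cells, the three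
COSTUME ports and the lower weights. [folklore] -/
theorem singularSurface_of_g16 {n : ℕ} (hP : ShadowPort n) (hM : MarkingPort n) (hDesc : DescentPort n)
    (hlow : ∀ n' : ℕ, 1 ≤ n' → n' < n → ForcedTowersTerminate n') (hO : OffLocusShadowTowersTerminate n)
    (hNP : NonPrincipalInLocusTowersTerminate n) (hPu : PurePrincipalTowersTerminate n)
    (hDr : DriftingTowersTerminate n) : SingularSurfaceHuggingTowersTerminate n :=
  singularSurface_of_g15 hP hM hO (inLocus_of_g16 hDesc hlow hNP hPu hDr)

/-- **EXACT at weight `n` below a terminating range** (ports + lower weights): 32260 at `n` ⟺ (O) ∧ (L, ¬P) ∧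
(L, P, pure) ∧ (L, P, drifting). [folklore] -/
theorem singularSurface_iff_g16 {n : ℕ} (hP : ShadowPort n) (hM : MarkingPort n) (hDesc : DescentPort n)
    (hlow : ∀ n' : ℕ, 1 ≤ n' → n' < n → ForcedTowersTerminate n') :
    SingularSurfaceHuggingTowersTerminate n ↔ OffLocusShadowTowersTerminate n ∧
      NonPrincipalInLocusTowersTerminate n ∧ PurePrincipalTowersTerminate n ∧ DriftingTowersTerminate n :=
  ⟨fun h => ⟨(pieces_of_singularSurface_g15 h).2.1, (cells_of_singularSurface h).1, (cells_of_singularSurface h).2.1,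
    (cells_of_singularSurface h).2.2.2⟩, fun h => singularSurface_of_g16 hP hM hDesc hlow h.1 h.2.1 h.2.2.1 h.2.2.2⟩

/-- **KERNEL — THE ROOT PIECE `ForcedTowersTerminate n` at weight `n` from the leaves at weight `n` and ALL forced
towers of lower weight** (tree kernel `SurfaceShadowKernels.ftt_iff_g11_leaves`, corner hypothesis discharged by the
tree's `CornerTowerDynamics.noCornerTowers_tree`).  The step of the strong induction. [folklore] -/
theorem ftt_step_of_g16 {n : ℕ} (hn : 1 ≤ n) (hMo : MonomialCorner n) (hC : CurveLaw n) (hSL : SurfaceLaw n)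
    (hH : HypersurfaceHuggingTowersTerminate n) (hP : ShadowPort n) (hM : MarkingPort n) (hDesc : DescentPort n)
    (hO : OffLocusShadowTowersTerminate n) (hNP : NonPrincipalInLocusTowersTerminate n)
    (hPu : PurePrincipalTowersTerminate n) (hDr : DriftingTowersTerminate n)
    (hlow : ∀ n' : ℕ, 1 ≤ n' → n' < n → ForcedTowersTerminate n') : ForcedTowersTerminate n :=
  (ftt_iff_g11_leaves hMo (CornerTowerDynamics.noCornerTowers_tree n hn) hC hSL).mpr
    ⟨singularSurface_of_g16 hP hM hDesc hlow hO hNP hPu hDr, hH⟩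

end Summit.ResolutionOfSingularities.ResolutionOfSingularities.Theorems.HugValuationCut
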